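import Summits.HodgeConjecture.CorCM.HypDel.M1primeOfFUPart1   -- E-FU part 1
import Summits.HodgeConjecture.CorCM.HypDel.M1primeOfFUPart4   -- E-FU part 4

/-!
# M1′ from (F) and (U) — E-FU PART 5 of 7 (+ HEAD `M1primeOfFU`): 
§ 7b/7c/8 — K1, K2, H1 discharged by name (B-p11, B-p12, B-p13, B-p21); § 9 — K3 `lamClauseTransportR` (B-p03 g10); `stubW3` CLOSED

Cell hodgecm-mathlib, rung 0 of the Mumford line under `HDel` (item `stmt-HodgeConjecture-24835`).  The E-FU text proves
`deligne1971_siegelModuliOnPoints` (M1′ = [Deligne 1971, 4.16–4.21 on points]) as a THEOREM of the two finer printed facts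
(F) `lan2013_siegelFineModuliScheme` [Lan 2013, Thm. 1.4.1.11 + Cor. 7.2.3.9] and (U) `siegelModuli_complexUniformisation`
[MFK94 App. 7A; Deligne 1971, 4.12–4.21; Milne 2005 Thm. 6.11]; it is split into a chain of part files only because of the
400-line cap on proof-bearing `Summits/` files (B-plan1 R22, director s96).  The composition and `theorem M1prime_of_F_U` live in
the HEAD file `Summits/HodgeConjecture/CorCM/HypDel/M1primeOfFU.lean`; provenance of every § is kept in its banner below and in
HOME `B-plan/lines/m1prime/M1primeOfFU.skeleton.md`.  This part does NOT depend on (F)/(U).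
HC_CM is proved only modulo the 7 printed citations until rung 0 closes.
-/

universe u   -- was declared inside the dropped D1 paste
open CategoryTheory CategoryTheory.Limits AlgebraicGeometry MonoidalCategory   -- was a TOP-LEVEL `open` of the dropped D1 paste (and of (M)); the pasted (F)/(U)/partC/§§ rely on it

/-! ═══════════════════════════════════════════════════════════════════════════════════════════════════════════════════
# § 7b — K1 (X+LEVEL half of H3) DISCHARGED BY NAME (by-import bases only: needs ★ p682042 `AbelianSchemeOverFibreIdentity`
# + ★ p684288 `SiegelAdelicMarkingLevelGlue`, both importing the ★ D-chain)
(closer-§ provenance and fold history: HOME `B-plan/lines/m1prime/M1primeOfFU.skeleton.md` + the by-import twin editions.) -/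

noncomputable section

namespace Summit.HodgeConjecture.CorCM.HypDel.M1primeOfFU

open CategoryTheory CategoryTheory.Limits AlgebraicGeometry
open Literature.AlgebraicGeometry
open Literature.AlgebraicGeometry.Motives (specOver AlgPoints AbelianVariety CartierDivisor)
open Literature.AlgebraicGeometry.AbelianSchemes (PolarizedAbelianSchemeWithLevel AbelianSchemeOver)
open Literature.AlgebraicGeometry.ModuliOfAbelianVarieties

/-- **K1 holds**: the X+LEVEL half of the triple transport along `𝟙 (Spec ℂ)`, by ★ (c-i)/(c-iv) p682042 and
★ (c-iv-glue) p684288. [cite: MumfordFogartyKirwan1994, Ch. 7 §2 Definition 7.3 (p. 130)]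
[cite: Milne2005ShimuraVarieties, §6 Thm. 6.11 p. 74 and p. 75] -/
theorem fibreLevelTransport (g N : ℕ) (δ : Fin g → ℕ) : FibreLevelTransport g N δ := by
  intro σ J J' a a' k hk hN0 P' Pσ P'' jσ hjσ m₁ Θ₁ Λ₁ h₁ m₂ Θ₂ Λ₂ h₂ fB hfB h hh
  refine ⟨(Grp.forget _).mapIso (AbelianSchemeOver.grpIsoOfFibreIso Pσ.A P''.A h), ?_, ?_, ?_⟩
  · change IsMonHom (AbelianSchemeOver.grpIsoOfFibreIso Pσ.A P''.A h).hom.hom.hom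
    infer_instance
  · change h.hom.hom.hom.hom.left ≫ pullback.fst P''.A.X.hom (𝟙 (Spec (CommRingCat.of ℂ))) =
      pullback.fst Pσ.A.X.hom (𝟙 (Spec (CommRingCat.of ℂ))) ≫
        (AbelianSchemeOver.grpIsoOfFibreIso Pσ.A P''.A h).hom.hom.hom.left
    haveI : IsIso (pullback.fst Pσ.A.X.hom (𝟙 (Spec (CommRingCat.of ℂ)))) :=
      AbelianSchemeOver.isIso_pullback_fst_id Pσ.A.X
    have e0 := AbelianSchemeOver.fibreIdToGrpIso_inv_left_fst Pσ.A
    -- `rw` cannot see through `(specOver ℚ ℂ).left = Spec ℂ` / `(A.fibre 𝟙).left = pullback …` (instances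
    -- transparency), hence `erw` — the pattern of ★ p682042 `section_comp_grpIso_eq`.
    have e2 : (AbelianSchemeOver.fibreIdToGrpIso Pσ.A).inv.hom.hom.left =
        inv (pullback.fst Pσ.A.X.hom (𝟙 (Spec (CommRingCat.of ℂ)))) :=
      IsIso.eq_inv_of_inv_hom_id (f := pullback.fst Pσ.A.X.hom (𝟙 (Spec (CommRingCat.of ℂ)))) e0
    have e1 : pullback.fst Pσ.A.X.hom (𝟙 (Spec (CommRingCat.of ℂ))) ≫
        (AbelianSchemeOver.fibreIdToGrpIso Pσ.A).inv.hom.hom.left = 𝟙 _ := by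
      rw [e2]
      exact IsIso.hom_inv_id _
    erw [AbelianSchemeOver.grpIsoOfFibreIso_hom_left, reassoc_of% e1, Category.id_comp]
    rfl
  · exact AbelianSchemeOver.levelStructure_isBaseChangeVia_id_of_fibreIso Pσ.level P''.level h
      (fun i => SiegelAdelicMarking.map_restrictPt_level_eq_of_conj_of_hom_eq hN0 σ.toRingEquiv Λ₁ m₁ h₁.2.2
        Λ₂ m₂ h₂.2.2 fB ⟨k, hk, hfB⟩ Pσ.level jσ.hom hjσ h hh i)

/-- **`StubW3` modulo H1, K2 ((c-ii-H)) and K3 ((c-iii)) on the by-import base.** [cite: Milne2005ShimuraVarieties, §14 Prop. 14.12 p. 125] -/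
theorem stubW3_of_H1_K2_K3 (PR : ∀ g N δ, SigmaReading g N δ) (H1 : ∀ g N δ, DBCSigmaExport PR g N δ)
    (K2 : ∀ g N δ, HatPoincareTransport g N δ) (K3 : ∀ g N δ, LamClauseTransport PR g N δ) : (∀ (g N : ℕ) (δ : Fin g → ℕ), StubW3 g N δ) :=
  stubW3_of_H1_K PR H1 fibreLevelTransport K2 K3

/-- **`StubW3` of record on the by-import base: modulo H1 (`DBCSigmaExportR`, B-p13), K2 (`HatPoincareTransport`,
★ p686114 + sequel), K3 (`LamClauseTransportR`, B-p21 `htower` → B-p03 (G5)).** [cite: Milne2005ShimuraVarieties, §14 Prop. 14.12 p. 125] -/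
theorem stubW3_of_record' (H1 : ∀ g N δ, DBCSigmaExportR g N δ) (K2 : ∀ g N δ, HatPoincareTransport g N δ)
    (K3 : ∀ g N δ, LamClauseTransportR g N δ) : (∀ (g N : ℕ) (δ : Fin g → ℕ), StubW3 g N δ) :=
  stubW3_of_H1_K2_K3 HPair H1 K2 K3

/-! ## § 7c — K2 DISCHARGE (B-p12 g11): `HatPoincareTransport` over ★ (c-ii-H) p686114 `AbelianSchemeDualTransport` +
★ p686511 `AbelianSchemeDualTransportUnit` (B-p01 g9)
(closer-§ provenance and fold history: HOME `B-plan/lines/m1prime/M1primeOfFU.skeleton.md` + the by-import twin editions.) -/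

/-- **K2 — the HAT / Poincaré half, DISCHARGED** over ★ `AbelianSchemeDualTransport` + ★ `AbelianSchemeDualTransportUnit`
(B-p01 g9, (c-ii-H)): for an isomorphism of `Spec ℂ`-group schemes `e : Xσ ≅ X″` between polarised abelian schemes the dual
transport `Ĥ_e = hatTransport P″.D Pσ.D e : X̂σ → X̂″` satisfies the HAT clause and the POINCARÉ clause of D4 `IsBaseChangeVia`
along `𝟙`. [cite: MilneAV2008, I §8 pp. 36–37] [cite: MumfordFogartyKirwan1994, Ch. 7 §2 Definition 7.3 (p. 130)] -/
theorem hatPoincareTransport (g N : ℕ) (δ : Fin g → ℕ) : HatPoincareTransport g N δ := by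
  intro Pσ P'' Θσ hΘσ Θ₂ hΘ₂ e he
  haveI : IsMonHom e.hom := he
  have wG : Pσ.A.X.hom ≫ (𝟙 (specOver ℚ ℂ) : specOver ℚ ℂ ⟶ specOver ℚ ℂ).left = e.hom.left ≫ P''.A.X.hom := by
    rw [Over.id_left, Category.comp_id, Over.w e.hom]
  have wĜ : Pσ.D.hat.X.hom ≫ (𝟙 (specOver ℚ ℂ) : specOver ℚ ℂ ⟶ specOver ℚ ℂ).left =
      AbelianSchemeOver.DualPair.hatTransport P''.D Pσ.D e ≫ P''.D.hat.X.hom := by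
    rw [Over.id_left, Category.comp_id, AbelianSchemeOver.DualPair.hatTransport_comp_hom]
  refine ⟨AbelianSchemeOver.DualPair.hatTransport P''.D Pσ.D e, ?_, wG, wĜ, ?_⟩
  · exact @AbelianSchemeOver.DualPair.hat_isBaseChangeVia_id_hatTransport_of_isLambdaOfAt ℂ _ P''.A Pσ.A P''.D Pσ.D
      e he e.symm (inferInstance : IsMonHom e.inv) rfl P''.pol.lam P''.pol.isMonHom Θ₂ hΘ₂ Pσ.pol.lam Pσ.pol.isMonHom
      Θσ hΘσ
  · exact AbelianSchemeOver.DualPair.nonempty_pullback_map_hatTransport_iso P''.D Pσ.D e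

/-- **`StubW3` of record modulo H1 (`DBCSigmaExportR`, B-p13) and K3 (`LamClauseTransportR`, B-p21 `htower` → B-p03 (G5)) ONLY**
— K1 (§ 7b, B-p11) and K2 (§ 7c) discharged by name on the by-import base. [cite: Milne2005ShimuraVarieties, §14 Prop. 14.12 p. 125] -/
theorem stubW3_of_H1_K3 (H1 : ∀ g N δ, DBCSigmaExportR g N δ) (K3 : ∀ g N δ, LamClauseTransportR g N δ) : (∀ (g N : ℕ) (δ : Fin g → ℕ), StubW3 g N δ) :=
  stubW3_of_record' H1 hatPoincareTransport K3

/-! ## § 8 — H1 OF RECORD DISCHARGED (B-p11 g11, R16 (b)): `DBCSigmaExportR` is a theorem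
over ★ p687984 `PolarizedAbelianSchemeWithLevelBaseChange` (B-p13: `rebaseSpecMap`, `rebaseSpecMapConjIso`,
`rebaseSpecMap_isBaseChangeVia`, `map_rebaseSpecMapConjIso_restrictPt_level`, the polarisation's own `exists_ample`) and
★ `PolarizedAbelianSchemeRebaseWeilPairing` (B-p11: `weilPairingLevel_rebaseSpecMap_eq_conjugate`, the `hpair` clause for ANY
(closer-§ provenance and fold history: HOME `B-plan/lines/m1prime/M1primeOfFU.skeleton.md` + the by-import twin editions.) -/

/-- **H1 of record — `DBCSigmaExportR` IS A THEOREM**: for `σ ∈ Aut(ℂ/ℚ)` and a triple `P′` over `Spec ℂ` (with any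
ample `IsLambdaOfAt` witness `Θ₁` at `𝟙`), the re-base `Pσ := P′.rebaseSpecMap σ = P′ ×_{Spec ℂ, Spec σ} Spec ℂ`
(D4 `IsBaseChangeVia` via the first projections), the fibre iso `jσ := P′.rebaseSpecMapConjIso σ : fibre(Pσ) ≅ fibre(P′)^σ`
reading `conjPoints σ` on the level sections, the polarisation's own ample witness `Θσ` at `𝟙`, AND the σ-reading of the
pairing `ē^{Θσ}_M(Pt, Qt) = σ (ē^{Θ₁}_M(P, Q))` whenever `jσ` carries `Pt, Qt` to `P^σ, Q^σ`
(★ `weilPairingLevel_rebaseSpecMap_eq_conjugate`). [cite: Milne2005ShimuraVarieties, §14 pp. 124–125 («σ(A, s, ηK) = (σA, σs, σηK)»)]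
[cite: MumfordFogartyKirwan1994, Ch. 7 §2 Definition 7.2 (p. 129)] [cite: Shimura1998, §18.6 proof (p. 130)] -/
theorem h1R (g N : ℕ) (δ : Fin g → ℕ) : DBCSigmaExportR g N δ := by
  intro σ P' Θ₁ _hΘ₁ hlam₁
  obtain ⟨Θσ, hΘσ, hlamσ⟩ := (P'.rebaseSpecMap σ).pol.exists_ample ℂ (𝟙 (Spec (CommRingCat.of ℂ)))
  refine ⟨P'.rebaseSpecMap σ, _, _, P'.rebaseSpecMapConjIso σ, Θσ, P'.rebaseSpecMap_isBaseChangeVia σ,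
    P'.map_rebaseSpecMapConjIso_restrictPt_level σ, hΘσ, hlamσ, ?_⟩
  intro M _hNM hM
  haveI := AbelianVariety.isDominant_toSchemeHom_zsmul_of_ne_zero
    ((P'.rebaseSpecMap σ).A.fibre (𝟙 (Spec (CommRingCat.of ℂ)))).toAbelianVariety hM
  haveI := AbelianVariety.isDominant_toSchemeHom_zsmul_of_ne_zero
    (P'.A.fibre (𝟙 (Spec (CommRingCat.of ℂ)))).toAbelianVariety hM
  intro P Q Pt Qt hPt hQt
  exact PolarizedAbelianSchemeWithLevel.weilPairingLevel_rebaseSpecMap_eq_conjugate σ P' hlam₁ hlamσ hM P Q Pt Qt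
    hPt hQt

/-- **`StubW3` modulo K3 ONLY** (H1 = `h1R`, H2 = `markedConjHomTransfer`, K1 = `fibreLevelTransport` (§ 7b), K2 =
`hatPoincareTransport` (§ 7c)); K3 = `LamClauseTransportR` (B-p03 § 9). [cite: Milne2005ShimuraVarieties, §14 Prop. 14.12 p. 125] -/
theorem stubW3_of_K3 (K3 : ∀ g N δ, LamClauseTransportR g N δ) : (∀ (g N : ℕ) (δ : Fin g → ℕ), StubW3 g N δ) :=
  stubW3_of_H1_K3 h1R K3

end Summit.HodgeConjecture.CorCM.HypDel.M1primeOfFU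

end

/-! ════════════════════════════════════════════════════
# § 9 — K3, THE λ HALF OF H3: `lamClauseTransportR` (B-p03 g10; W3c (c-iii))
(closer-§ provenance and fold history: HOME `B-plan/lines/m1prime/M1primeOfFU.skeleton.md` + the by-import twin editions.) -/

noncomputable section

namespace Summit.HodgeConjecture.CorCM.HypDel.M1primeOfFU

open CategoryTheory CategoryTheory.Limits AlgebraicGeometry
open Literature.AlgebraicGeometry
open Literature.AlgebraicGeometry.Motives (specOver AlgPoints AbelianVariety CartierDivisor)
open Literature.AlgebraicGeometry.AbelianSchemes (PolarizedAbelianSchemeWithLevel AbelianSchemeOver)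
open Literature.AlgebraicGeometry.AbelianSchemes.AbelianSchemeOver
open Literature.AlgebraicGeometry.ModuliOfAbelianVarieties
open scoped MonObj

/-- **K3 — the λ half of H3, CLOSED** (`LamClauseTransportR` of § 7 v3): for every input of the triple transport along
`𝟙 (Spec ℂ)`, the λ-clause `Pσ.pol.lam.left ≫ Ĥ = e.hom.left ≫ P″.pol.lam.left` of D4 `IsBaseChangeVia` holds — polarisation
rigidity ([MumfordFogartyKirwan1994, Ch. 6 §2 Def. 6.2–6.3; Ch. 7 §2 Def. 7.3], [Milne2005ShimuraVarieties, §14 Prop. 14.12]).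
[cite: MumfordFogartyKirwan1994, Ch. 7 §2 Definition 7.3 (p. 130)] [cite: Milne2005ShimuraVarieties, §14 Prop. 14.12 p. 125]
[cite: Lange2023AbelianVarietiesComplex, §2.4.1 Cor. 2.4.11 (PDF p. 117)] -/
theorem lamClauseTransportR (g N : ℕ) (δ : Fin g → ℕ) : LamClauseTransportR g N δ := by
  intro hg hδ hN3 σ J J' a a' k hk P' Pσ P'' G Ĝ hσ jσ hjσ Θσ hΘa hΘl m₁ Θ₁ Λ₁ h₁ hPR m₂ Θ₂ Λ₂ h₂ fB hfB h hh
    e hem her hel Ĥ hhat wG wĜ hP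
  have hN : N ≠ 0 := by omega
  haveI : IsMonHom e.hom := hem
  haveI hinv : IsMonHom e.inv := inferInstance
  haveI : IsMonHom e.symm.hom := hinv
  haveI : IsMonHom Pσ.pol.lam := Pσ.pol.isMonHom
  haveI : IsMonHom P''.pol.lam := P''.pol.isMonHom
  -- (K3-a): `Ĥ` IS the dual transport `Ĥ_e`
  have hĤ : Ĥ = DualPair.hatTransport P''.D Pσ.D e :=
    DualPair.eq_hatTransport_of_nonempty_pullback_map_iso P''.D Pσ.D e Ĥ wG wĜ hP
  rw [hĤ]
  -- the transported morphism `λ_T := e⁻¹ ≫ λσ ≫ Ĥ_e : X″ ⟶ X̂″`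
  set lamT : P''.A.X ⟶ P''.D.hat.X := DualPair.lamTransport Pσ.D P''.D e.symm e Pσ.pol.lam with hlamT
  haveI hmonT : IsMonHom lamT := by
    rw [hlamT]
    -- all instance arguments EXPLICIT: the lemma is stated over `Spec (.of K)`, K3's objects live over
    -- `(specOver ℚ ℂ).left` (definitionally, not reducibly, equal — instance search would not re-find `hem`)
    haveI : IsMonHom (DualPair.hatTransportOver P''.D Pσ.D e) :=
      @DualPair.isMonHom_hatTransportOver_of_isLambdaOfAt ℂ _ P''.A Pσ.A P''.D Pσ.D e hem P''.pol.lam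
        P''.pol.isMonHom Θ₂ h₂.2.1 Pσ.pol.lam Pσ.pol.isMonHom Θσ hΘl
    change IsMonHom (e.symm.hom ≫ Pσ.pol.lam ≫ DualPair.hatTransportOver P''.D Pσ.D e)
    infer_instance
  -- it suffices that `λ_T = λ″` as morphisms over `Spec ℂ`
  suffices hsuff : lamT = P''.pol.lam by
    have hl : (DualPair.lamTransport Pσ.D P''.D e.symm e Pσ.pol.lam).left = P''.pol.lam.left := by
      rw [← hlamT, hsuff]
    rw [DualPair.lamTransport_left] at hl
    -- `hl : e⁻¹ ≫ λσ ≫ Ĥ_e = λ″` on underlying schemes; precompose with `e`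
    have he : e.hom.left ≫ e.symm.hom.left = 𝟙 _ := by
      rw [← Over.comp_left, Iso.symm_hom, Iso.hom_inv_id, Over.id_left]
    calc Pσ.pol.lam.left ≫ DualPair.hatTransport P''.D Pσ.D e
        = (e.hom.left ≫ e.symm.hom.left) ≫ Pσ.pol.lam.left ≫ DualPair.hatTransport P''.D Pσ.D e := by
          rw [he, Category.id_comp]
      _ = e.hom.left ≫ (e.symm.hom.left ≫ Pσ.pol.lam.left ≫ DualPair.hatTransport P''.D Pσ.D e) := by
          simp only [Category.assoc]
      _ = e.hom.left ≫ P''.pol.lam.left := by rw [hl]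
  -- faithfulness of the identity fibre: it suffices that the FIBRE homomorphisms at `𝟙` agree
  suffices hF : fibreHom lamT (𝟙 (Spec (CommRingCat.of ℂ))) = fibreHom P''.pol.lam (𝟙 (Spec (CommRingCat.of ℂ))) by
    have hmap : (Over.pullback (𝟙 (Spec (CommRingCat.of ℂ)))).map lamT =
        (Over.pullback (𝟙 (Spec (CommRingCat.of ℂ)))).map P''.pol.lam := by
      have h3 := congrArg (fun φ => φ.hom.hom.hom) hF
      simp only [fibreHom_hom_hom_hom] at h3
      exact h3
    haveI : (Over.pullback (𝟙 (Spec (CommRingCat.of ℂ))) :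
        Over (Spec (CommRingCat.of ℂ)) ⥤ Over (Spec (CommRingCat.of ℂ))).Faithful :=
      Functor.Faithful.of_iso (overPullbackIdIso (Spec (CommRingCat.of ℂ))).symm
    exact (Over.pullback (𝟙 (Spec (CommRingCat.of ℂ)))).map_injective hmap
  -- the data of ★ `eq_of_slice_dictionary_of_weilPairingLevel_towers` on the `P″`-fibre
  -- the transported witness `Θ_T := e_𝟙^* Θσ` and its `IsLambdaOfAt`
  haveI hdomT := isDominant_toSchemeHom_fibreIsoOfIso (A := Pσ.A) (A' := P''.A) e.symm
    (𝟙 (Spec (CommRingCat.of ℂ)))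
  have hΛT : P''.A.IsLambdaOfAt (𝟙 (Spec (CommRingCat.of ℂ))) P''.D lamT
      (Θσ.pullback (AbelianVariety.Hom.toSchemeHom
        (fibreIsoOfIso (A := Pσ.A) (A' := P''.A) e.symm (𝟙 (Spec (CommRingCat.of ℂ)))).hom)) := by
    rw [hlamT]
    exact DualPair.isLambdaOfAt_lamTransport (D := Pσ.D) (D' := P''.D) (e := e.symm) (e' := e)
      (lam := Pσ.pol.lam) (s := 𝟙 (Spec (CommRingCat.of ℂ))) rfl hΘl
  -- ampleness of `Θ_T` (pull-back along an isomorphism)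
  haveI : IsIso (AbelianVariety.Hom.toSchemeHom
      (fibreIsoOfIso (A := Pσ.A) (A' := P''.A) e.symm (𝟙 (Spec (CommRingCat.of ℂ)))).hom) :=
    isIso_toSchemeHom_of_iso _
  have hΘTa : (Θσ.pullback (AbelianVariety.Hom.toSchemeHom
      (fibreIsoOfIso (A := Pσ.A) (A' := P''.A) e.symm (𝟙 (Spec (CommRingCat.of ℂ)))).hom)).IsAmple :=
    hΘa.pullback _
  -- the fibre iso `h` READS `e` (K1's `FibreReads`), hence `e.symm`'s fibre iso is `h⁻¹` on underlying schemes
  have hφ : AbelianVariety.Hom.toSchemeHom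
      (fibreIsoOfIso (A := Pσ.A) (A' := P''.A) e.symm (𝟙 (Spec (CommRingCat.of ℂ)))).hom =
      AbelianVariety.Hom.toSchemeHom h.inv := by
    -- the instance is ASCRIBED in this file's form `𝟙 (Spec ℂ)` (the lemma yields `𝟙 ((specOver ℚ ℂ).left)`,
    -- equal definitionally but not at instances transparency — pattern of § 7b `fibreLevelTransport`)
    haveI : IsIso (pullback.fst Pσ.A.X.hom (𝟙 (Spec (CommRingCat.of ℂ)))) := isIso_pullback_fst_id Pσ.A.X
    -- both read `pr_{X″} ≫ e⁻¹` over the first projection `pr_{Xσ}` (an isomorphism: `𝟙`-fibre)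
    have h1 : AbelianVariety.Hom.toSchemeHom
          (fibreIsoOfIso (A := Pσ.A) (A' := P''.A) e.symm (𝟙 (Spec (CommRingCat.of ℂ)))).hom ≫
          pullback.fst Pσ.A.X.hom (𝟙 (Spec (CommRingCat.of ℂ))) =
        pullback.fst P''.A.X.hom (𝟙 (Spec (CommRingCat.of ℂ))) ≫ e.symm.hom.left :=
      fibreIsoOfIso_hom_toSchemeHom_fst e.symm (𝟙 (Spec (CommRingCat.of ℂ)))
    -- name the underlying scheme maps of `h`, `h⁻¹` with `pullback`-form types (the `fibre`-form of the
    -- fibres' underlying schemes is only definitionally equal, which `rw` does not see)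
    obtain ⟨Hh, hHh⟩ : ∃ Hh : pullback Pσ.A.X.hom (𝟙 (Spec (CommRingCat.of ℂ))) ⟶
        pullback P''.A.X.hom (𝟙 (Spec (CommRingCat.of ℂ))), Hh = AbelianVariety.Hom.toSchemeHom h.hom := ⟨_, rfl⟩
    obtain ⟨Hi, hHi⟩ : ∃ Hi : pullback P''.A.X.hom (𝟙 (Spec (CommRingCat.of ℂ))) ⟶
        pullback Pσ.A.X.hom (𝟙 (Spec (CommRingCat.of ℂ))), Hi = AbelianVariety.Hom.toSchemeHom h.inv := ⟨_, rfl⟩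
    -- `h ≫ pr_{X″} = pr_{Xσ} ≫ e` (K1's `FibreReads`), `h⁻¹ ≫ h = 1`, `e ≫ e⁻¹ = 1`
    have her' : Hh ≫ pullback.fst P''.A.X.hom (𝟙 (Spec (CommRingCat.of ℂ))) =
        pullback.fst Pσ.A.X.hom (𝟙 (Spec (CommRingCat.of ℂ))) ≫ e.hom.left := by
      rw [hHh]; exact her
    have hid : Hi ≫ Hh = 𝟙 _ := by
      rw [hHi, hHh]
      change (h.inv ≫ h.hom).hom.hom.hom.left = 𝟙 _
      rw [Iso.inv_hom_id]
      rfl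
    have heinv : e.hom.left ≫ e.symm.hom.left = 𝟙 _ := by
      rw [← Over.comp_left, Iso.symm_hom, Iso.hom_inv_id, Over.id_left]
    have t0 : pullback.fst Pσ.A.X.hom (𝟙 (Spec (CommRingCat.of ℂ))) =
        (pullback.fst Pσ.A.X.hom (𝟙 (Spec (CommRingCat.of ℂ))) ≫ e.hom.left) ≫ e.symm.hom.left := by
      rw [Category.assoc, heinv, Category.comp_id]
    -- hence `h⁻¹ ≫ pr_{Xσ} = pr_{X″} ≫ e⁻¹`
    have h2 : Hi ≫ pullback.fst Pσ.A.X.hom (𝟙 (Spec (CommRingCat.of ℂ))) =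
        pullback.fst P''.A.X.hom (𝟙 (Spec (CommRingCat.of ℂ))) ≫ e.symm.hom.left :=
      calc Hi ≫ pullback.fst Pσ.A.X.hom (𝟙 (Spec (CommRingCat.of ℂ)))
          = Hi ≫ (pullback.fst Pσ.A.X.hom (𝟙 (Spec (CommRingCat.of ℂ))) ≫ e.hom.left) ≫ e.symm.hom.left := by
            rw [← t0]
        _ = Hi ≫ (Hh ≫ pullback.fst P''.A.X.hom (𝟙 (Spec (CommRingCat.of ℂ)))) ≫ e.symm.hom.left := by rw [her']
        _ = (Hi ≫ Hh) ≫ pullback.fst P''.A.X.hom (𝟙 (Spec (CommRingCat.of ℂ))) ≫ e.symm.hom.left := by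
            simp only [Category.assoc]
        _ = pullback.fst P''.A.X.hom (𝟙 (Spec (CommRingCat.of ℂ))) ≫ e.symm.hom.left := by
            rw [hid, Category.id_comp]
    subst hHi
    exact (cancel_mono (pullback.fst Pσ.A.X.hom (𝟙 (Spec (CommRingCat.of ℂ))))).mp (h1.trans h2.symm)
  -- `htower` on the `P″`-fibre: B-p21's rebase tower on `fibre(Pσ)`, moved along `h`
  haveI hdh : IsDominant (AbelianVariety.Hom.toSchemeHom h.hom) :=
    Motives.AbelianVariety.isDominant_toSchemeHom_iso_hom h
  haveI hdhi : IsDominant (AbelianVariety.Hom.toSchemeHom h.inv) :=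
    Motives.AbelianVariety.isDominant_toSchemeHom_iso_hom h.symm
  have hdim : 0 < ((P''.A.fibre (𝟙 (Spec (CommRingCat.of ℂ)))).toAbelianVariety).dim :=
    dim_fibre_pos_of_isOfRelDim hg P''.relDim _
  have hfin := finite_ker_fibreHom_of_hasType P''.pol P''.hasType (𝟙 (Spec (CommRingCat.of ℂ)))
  -- pull-back of `Θσ` along `e.symm`'s fibre iso = along `h⁻¹` (same scheme morphism)
  have hΘeq : Θσ.pullback (AbelianVariety.Hom.toSchemeHom
        (fibreIsoOfIso (A := Pσ.A) (A' := P''.A) e.symm (𝟙 (Spec (CommRingCat.of ℂ)))).hom) =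
      Θσ.pullback (AbelianVariety.Hom.toSchemeHom h.inv) := by
    have key : ∀ (f₁ f₂ : ((P''.A.fibre (𝟙 (Spec (CommRingCat.of ℂ)))).toAbelianVariety).X.left ⟶
        ((Pσ.A.fibre (𝟙 (Spec (CommRingCat.of ℂ)))).toAbelianVariety).X.left)
        [IsDominant f₁] [IsDominant f₂], f₁ = f₂ → Θσ.pullback f₁ = Θσ.pullback f₂ := by
      intro f₁ f₂ _ _ hf
      subst hf
      rfl
    exact key _ _ hφ
  refine Literature.AlgebraicGeometry.AbelianVarieties.eq_of_slice_dictionary_of_weilPairingLevel_towers hdim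
    (fibreHom P''.pol.lam (𝟙 (Spec (CommRingCat.of ℂ)))) (fibreHom lamT (𝟙 (Spec (CommRingCat.of ℂ))))
    hfin h₂.1 hΘTa ?_ hN ?_
  · -- the dictionary: fibre points read `valueAt`, and (D-1) with the two `IsLambdaOfAt` witnesses
    intro Q Q'
    exact (algPointsMap_fibreHom_eq_iff P''.A (𝟙 (Spec (CommRingCat.of ℂ))) P''.D P''.pol.lam lamT Q Q').trans
      (P''.D.valueAt_eq_iff_nonempty_iso_of_isLambdaOfAt (𝟙 (Spec (CommRingCat.of ℂ))) h₂.2.1 hΛT Q' Q)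
  · -- the tower
    intro M hNM hMC
    obtain ⟨b, hb, hbPQ⟩ := SiegelAdelicMarking.exists_isCoprime_weilPairingLevel_eq_pullback_zpow_rebase hN σ hk
      Λ₁ m₁ h₁.2.2 Λ₂ m₂ h₂.2.2 jσ Θσ hPR fB hfB h hh hNM hMC
    refine ⟨b, hb, fun P Q => ?_⟩
    haveI := Literature.AlgebraicGeometry.Motives.AbelianVariety.isDominant_toSchemeHom_zsmul_of_ne_zero
      ((P''.A.fibre (𝟙 (Spec (CommRingCat.of ℂ)))).toAbelianVariety) hMC
    haveI := Literature.AlgebraicGeometry.Motives.AbelianVariety.isDominant_toSchemeHom_zsmul_of_ne_zero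
      ((Pσ.A.fibre (𝟙 (Spec (CommRingCat.of ℂ)))).toAbelianVariety) hMC
    rw [hΘeq]
    exact Literature.AlgebraicGeometry.Motives.AbelianVariety.forall_weilPairingLevel_pullback_inv_eq_zpow_of_iso
      h Θσ Θ₂ b hbPQ P Q

end Summit.HodgeConjecture.CorCM.HypDel.M1primeOfFU

end

/-! ## W3 CLOSED: `stubW3 := stubW3_of_K3 lamClauseTransportR` — relocated from the running head -/

namespace Summit.HodgeConjecture.CorCM.HypDel.M1primeOfFU

open Literature.AlgebraicGeometry.ModuliOfAbelianVarieties

/-- W3 CLOSED OUTRIGHT (B-p11 § 7 v3 + § 7b + B-p12 § 7c + B-p11 § 8 + B-p03 § 9: H1 by `h1R`, H2 by ★ (W3-J), K1 by `fibreLevelTransport`,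
K2 by `hatPoincareTransport`, K3 by `lamClauseTransportR`), re-exported under the head's naming. JUNCTION (problem-side composition, not a printed claim; locator = the printed statement it assembles)
[cite: Milne2005ShimuraVarieties, §14 Prop. 14.12 p. 125, §6 Thm. 6.11 p. 74] [cite: Deligne1971TravauxShimura, 4.16–4.17 p. 150] -/
theorem stubW3 : (∀ (g N : ℕ) (δ : Fin g → ℕ), StubW3 g N δ) :=
  stubW3_of_K3 lamClauseTransportR

end Summit.HodgeConjecture.CorCM.HypDel.M1primeOfFU
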